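import Summits.QuantumFields.BalabanUV.Beta.GAN24.EffectiveFormLocalisation

/-!
# `BalabanUV.Beta.GAN24.EffectiveFormRateTransfer` — binder row G-an2-4 ∕ (CONV-C), route R6 «VALUES, NOT DERIVATIVES», PART 107:
# «Σ's RATE IS P's RATE» IN THE ROW's OWN CURRENCY — the entrywise-with-decay ONE-STEP RATE of the effective form `𝒮 = effForm H Q` follows from the
# entrywise-with-decay one-step rate of the unit-lattice block propagator `P = QK⁻¹Qᵀ` (`K = H + Qᵀ(a•1)Q`, Bałaban's `QG_kQ*`), LINEARLY, by the second
# resolvent identity `P⁻¹ − P′⁻¹ = P⁻¹(P′ − P)P′⁻¹` and PART 105's localisation of `P⁻¹ = 𝒮 + a•1`; constants explicit and volume-free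
# (unit b2b-balaban-gan24-p3, gen 50; v1)

NOT IN PRINT; OUR PROOF (for the ROUTE; [folklore] — `B4Sect5Proof.inv_sub_inv_eq` (the p. 597 difference of [B4] taken exactly), `B4Sect5Torus.inv_decay` via
`FP.WellConditionedInverseLocality.abs_inv_le_of_coercive_localised`, and PART 105 `blockProp_coercive_of_ub` ∕ `isSymm_blockProp` BY NAME; the (5.10)-type
mechanism of [Balaban1983RegularityDecay] Sect. 5 made LINEAR in the perturbation, as road P2's `GAN24.DirichletExhaustion.perturb_rate` does on `ℤ^d` — here on a
finite unit index set with a pseudo-distance, the currency of PART 105).  HONEST FRAMING (cell contract, verbatim): «discharging `BetaPertH` makes Bałaban's UV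
stability UNCONDITIONAL — a real constructive-QFT result; it is NOT the continuum limit and NOT the Clay problem.»  HONEST DEPENDENCY (verbatim): «continuum YM on
T⁴ ⇐ BetaPertH ∧ nine spine estimates (0/9 proved); BetaPertH ⇐ (D1) ∧ (D4) ∧ CAP+tail; G-an2-4 gates asym, D1 and NE2/3/4.»

WHY THIS FILE.  ROUTES-GAN24 §0 (0.2) v4 note: «Σ = (QK⁻¹Qᵀ)⁻¹ = the ONE-STEP effective form of Δ^{(k)}(1) … Σ's rate IS Δ's rate one level up … What remains for
Ξ ∕ Σ is BOOKKEEPING [TO PROVE, S-size]: operator-norm → entrywise-with-decay on the unit torus».  PART 105 typed the DECAY half for `𝒮` (and `ℋ`; PART 106 `𝒢`)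
from the soft resolvent; THIS FILE types the RATE half for `𝒮` in the row's own two-clause currency: if the block propagators `P_k = Q_kK_k⁻¹Q_kᵀ` of two (or of a
tower of) constrained data on the SAME unit index set satisfy the (CONV-C) clauses — k-uniform decay `c₀e^{−δ₀ρ}` and Cauchy step `ε·e^{−δ₀ρ}` — and the upper bound
`Λ` is k-uniform, then `𝒮_k` satisfies both clauses with `(2(Λ+a)+a, t)` and `4(Λ+a)²Kf(t∕2)²·ε` at rate `t∕2`, `t = rate Kf (Λ+a)⁻¹ c₀ δ₀`.  So for the effective-form
constituent the whole of (CONV-C) reduces to (CONV-C) for the `QG_kQ*` constituent plus the upper bound — one constituent fewer on the row's list (the `H_k` and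
`C^{(k)}` blocks live on DIFFERENT fine lattices at consecutive levels and need the one-step averaging to be compared; not done here).

WHAT THIS FILE PROVES (0 sorry, 0 `def`, nothing cited; unit index `c`, pseudo-distance `ρ`, profile `Kf`):
* §1 `sum_sum_exp_le` — the unit-lattice DOUBLE CONVOLUTION `Σ_{b₁,b₂} e^{−tρ(b,b₁)}e^{−tρ(b₁,b₂)}e^{−tρ(b₂,b′)} ≤ Kf(t∕2)²·e^{−(t∕2)ρ(b,b′)}`.
* §2 **`abs_inv_sub_inv_le`** — LINEAR PERTURBATION OF A WELL-CONDITIONED LOCALISED INVERSE: `A, A′` symmetric, `γ`-coercive, `|A|, |A′| ≤ c₀e^{−δ₀ρ}`, `|A − A′| ≤ εe^{−δ₀ρ}`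
  ⟹ `|(A⁻¹ − A′⁻¹)(b,b′)| ≤ (2∕γ)²·ε·Kf(t∕2)²·e^{−(t∕2)ρ(b,b′)}`, `t = rate Kf γ c₀ δ₀`.
* §3 **`abs_effForm_sub_effForm_le`** — Σ's RATE IS P's RATE: two constrained data `(H, Q)` on `ν` and `(H′, Q′)` on `ν′` over the same unit index set, both with PART 105's
  hypotheses (`H` PSD, `a > 0`, `K` coercive, upper bound `Λ`, `|P| ≤ c₀e^{−δ₀ρ}`) and `|(P − P′)(b,b′)| ≤ εe^{−δ₀ρ(b,b′)}` ⟹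
  `|(𝒮 − 𝒮′)(b,b′)| ≤ 4(Λ+a)²·ε·Kf(t∕2)²·e^{−(t∕2)ρ(b,b′)}`, `t = rate Kf (Λ+a)⁻¹ c₀ δ₀`.
* §4 **`effForm_two_clauses_of_blockProp`** — the TOWER form: fine index sets `ν k`, data `(H k, Q k)`, k-uniform letters, `|(P_{k+1} − P_k)(b,b′)| ≤ C₄θ^k e^{−δ₀ρ}` ⟹
  `|𝒮_k(b,b′)| ≤ (2(Λ+a)+a)e^{−(t∕2)ρ}` and `|(𝒮_{k+1} − 𝒮_k)(b,b′)| ≤ 4(Λ+a)²Kf(t∕2)²C₄·θ^k·e^{−(t∕2)ρ}` — the two clauses of (CONV-C) for the effective form, from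
  those of the block propagator.
WHAT IT DOES NOT DO: supply P's clauses (at `U = 1` that is road P2's ∕ the NE2 lane's `QG_kQ*` business — «Q𝒢Q* (R0)» on the list; with background it is Bałaban-class);
the `ℋ` ∕ `𝒢` blocks' rates (different fine lattices); instantiate on a lattice.  SUPPLIER work on route C-R6° (rank 2, REDUCTION); no consumer of record; NEVER «G-an2-4
closed»; NOT (CONV-C), NOT D1, NOT `BetaPertH`, NOT continuum, NOT Clay.  Records: `HOME/b2b-balaban-gan24-p3/gen50/README.md`.
-/

noncomputable section

open scoped BigOperators Matrix
open Finset Matrix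
open Literature.MathematicalPhysics.QuantumFieldTheory.Balaban1983to89
open Literature.MathematicalPhysics.QuantumFieldTheory.Balaban1983to89.B4Sect5Torus (IsPseudoDist SumBound rate rate_pos rate_le_delta0)
open Literature.MathematicalPhysics.QuantumFieldTheory.Balaban1983to89.Beta.Composition (kkt blockProp)
open Literature.MathematicalPhysics.QuantumFieldTheory.Balaban1983to89.Beta.CompositionSingular (effForm minOp effForm_eq_of_reg)
open Summit.QuantumFields.BalabanUV.Beta.FP.WellConditionedInverseLocality (abs_inv_le_of_coercive_localised)
open Summit.QuantumFields.BalabanUV.Beta.GAN24.EffectiveFormLocalisation (transpose_reg blockProp_coercive_of_ub isUnit_det_of_coercive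
  isUnit_det_of_coercive_fine isSymm_blockProp abs_effForm_le)

namespace Summit.QuantumFields.BalabanUV.Beta.GAN24.EffectiveFormRateTransfer

variable {c : Type*} [Fintype c] [DecidableEq c]
variable {ρ : c → c → ℝ} {Kf : ℝ → ℝ}

/-! ## §1 The unit-lattice double convolution -/

omit [DecidableEq c] in
/-- **DOUBLE CONVOLUTION OF EXPONENTIAL PROFILES**: `ρ` a pseudo-distance with profile `Kf`, `t > 0` ⟹
`Σ_{b₁,b₂} e^{−tρ(b,b₁)}·e^{−tρ(b₁,b₂)}·e^{−tρ(b₂,b′)} ≤ Kf(t∕2)²·e^{−(t∕2)ρ(b,b′)}` (triangle inequality twice; drop `e^{−(t∕2)ρ(b₁,b₂)} ≤ 1`). [folklore] -/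
theorem sum_sum_exp_le (hKf : ∀ r, 0 < r → 0 ≤ Kf r) (hρ : IsPseudoDist ρ) (hS : SumBound ρ Kf) {t : ℝ} (ht : 0 < t) (b b' : c) :
    ∑ b₁, ∑ b₂, Real.exp (-(t * ρ b b₁)) * Real.exp (-(t * ρ b₁ b₂)) * Real.exp (-(t * ρ b₂ b')) ≤
      Kf (t / 2) ^ 2 * Real.exp (-(t / 2 * ρ b b')) := by
  have hpt : ∀ b₁ b₂, Real.exp (-(t * ρ b b₁)) * Real.exp (-(t * ρ b₁ b₂)) * Real.exp (-(t * ρ b₂ b')) ≤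
      Real.exp (-(t / 2 * ρ b b')) * (Real.exp (-(t / 2 * ρ b b₁)) * Real.exp (-(t / 2 * ρ b' b₂))) := fun b₁ b₂ => by
    rw [← Real.exp_add, ← Real.exp_add, ← Real.exp_add, ← Real.exp_add]
    apply Real.exp_le_exp.mpr
    have h1 := hρ.triangle b b₁ b'
    have h2 := hρ.triangle b₁ b₂ b'
    have h3 := hρ.nonneg b b₁
    have h4 := hρ.nonneg b₁ b₂
    have h5 := hρ.nonneg b₂ b'
    rw [hρ.symm b' b₂]
    nlinarith
  have hK : 0 ≤ Kf (t / 2) := hKf _ (by linarith)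
  calc ∑ b₁, ∑ b₂, Real.exp (-(t * ρ b b₁)) * Real.exp (-(t * ρ b₁ b₂)) * Real.exp (-(t * ρ b₂ b'))
      ≤ ∑ b₁, ∑ b₂, Real.exp (-(t / 2 * ρ b b')) * (Real.exp (-(t / 2 * ρ b b₁)) * Real.exp (-(t / 2 * ρ b' b₂))) :=
        Finset.sum_le_sum fun b₁ _ => Finset.sum_le_sum fun b₂ _ => hpt b₁ b₂
    _ = Real.exp (-(t / 2 * ρ b b')) * ((∑ b₁, Real.exp (-(t / 2 * ρ b b₁))) * ∑ b₂, Real.exp (-(t / 2 * ρ b' b₂))) := by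
        rw [Finset.sum_mul_sum, Finset.mul_sum]
        refine Finset.sum_congr rfl fun b₁ _ => ?_
        rw [Finset.mul_sum]
    _ ≤ Real.exp (-(t / 2 * ρ b b')) * (Kf (t / 2) * Kf (t / 2)) := by
        apply mul_le_mul_of_nonneg_left _ (Real.exp_pos _).le
        exact mul_le_mul (hS _ (by linarith) b) (hS _ (by linarith) b') (Finset.sum_nonneg fun _ _ => (Real.exp_pos _).le) hK
    _ = Kf (t / 2) ^ 2 * Real.exp (-(t / 2 * ρ b b')) := by ring

/-! ## §2 Linear perturbation of a well-conditioned, localised inverse -/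

/-- **`abs_inv_sub_inv_le` — THE SECOND RESOLVENT IDENTITY, ENTRYWISE WITH DECAY, LINEAR IN THE PERTURBATION** [our proof; `B4Sect5Proof.inv_sub_inv_eq` +
`abs_inv_le_of_coercive_localised` + §1]: `A, A′` symmetric and `γ`-coercive (`γ > 0`), `|A(b,b′)|, |A′(b,b′)| ≤ c₀e^{−δ₀ρ(b,b′)}` (`c₀ ≥ 0`, `δ₀ > 0`), and the RATE letter
`|(A − A′)(b,b′)| ≤ εe^{−δ₀ρ(b,b′)}` (`ε ≥ 0`) ⟹ `|(A⁻¹ − A′⁻¹)(b,b′)| ≤ (2∕γ)²·ε·Kf(t∕2)²·e^{−(t∕2)ρ(b,b′)}`, `t = rate Kf γ c₀ δ₀`. -/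
theorem abs_inv_sub_inv_le (hKf : ∀ r, 0 < r → 0 ≤ Kf r) (hρ : IsPseudoDist ρ) (hS : SumBound ρ Kf)
    {A A' : Matrix c c ℝ} (hAs : A.IsSymm) (hA's : A'.IsSymm) {γ c₀ δ₀ ε : ℝ} (hγ : 0 < γ) (hc₀ : 0 ≤ c₀) (hδ₀ : 0 < δ₀) (hε : 0 ≤ ε)
    (hAco : QGQInverse.Coercive A γ) (hA'co : QGQInverse.Coercive A' γ)
    (hA : ∀ b b', |A b b'| ≤ c₀ * Real.exp (-(δ₀ * ρ b b'))) (hA' : ∀ b b', |A' b b'| ≤ c₀ * Real.exp (-(δ₀ * ρ b b')))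
    (hdiff : ∀ b b', |(A - A') b b'| ≤ ε * Real.exp (-(δ₀ * ρ b b'))) (b b' : c) :
    |(A⁻¹ - A'⁻¹) b b'| ≤ (2 / γ) ^ 2 * ε * Kf (rate Kf γ c₀ δ₀ / 2) ^ 2 * Real.exp (-(rate Kf γ c₀ δ₀ / 2 * ρ b b')) := by
  set t : ℝ := rate Kf γ c₀ δ₀ with ht
  have htpos : 0 < t := rate_pos hKf hγ hc₀ hδ₀
  have htδ : t ≤ δ₀ := rate_le_delta0 Kf γ c₀ hδ₀
  have hinvA : ∀ p q, |A⁻¹ p q| ≤ 2 / γ * Real.exp (-(t * ρ p q)) := abs_inv_le_of_coercive_localised hKf hρ hS hAs hγ hc₀ hδ₀ hAco hA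
  have hinvA' : ∀ p q, |A'⁻¹ p q| ≤ 2 / γ * Real.exp (-(t * ρ p q)) := abs_inv_le_of_coercive_localised hKf hρ hS hA's hγ hc₀ hδ₀ hA'co hA'
  -- the rate letter at the weaker rate `t ≤ δ₀`
  have hmid : ∀ p q, |(A' - A) p q| ≤ ε * Real.exp (-(t * ρ p q)) := fun p q => by
    rw [← neg_sub, Matrix.neg_apply, abs_neg]
    refine (hdiff p q).trans (mul_le_mul_of_nonneg_left (Real.exp_le_exp.mpr ?_) hε)
    have := hρ.nonneg p q
    nlinarith
  -- the second resolvent identity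
  have hid : A⁻¹ - A'⁻¹ = A⁻¹ * (A' - A) * A'⁻¹ :=
    B4Sect5Proof.inv_sub_inv_eq (QGQInverse.isUnit_of_coercive hγ hAco) (QGQInverse.isUnit_of_coercive hγ hA'co)
  rw [hid, Matrix.mul_apply]
  have hγ2 : 0 ≤ 2 / γ := by positivity
  calc |∑ b₂, (A⁻¹ * (A' - A)) b b₂ * A'⁻¹ b₂ b'|
      ≤ ∑ b₂, |(A⁻¹ * (A' - A)) b b₂ * A'⁻¹ b₂ b'| := Finset.abs_sum_le_sum_abs _ _
    _ ≤ ∑ b₂, (∑ b₁, 2 / γ * Real.exp (-(t * ρ b b₁)) * (ε * Real.exp (-(t * ρ b₁ b₂)))) * (2 / γ * Real.exp (-(t * ρ b₂ b'))) :=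
        Finset.sum_le_sum fun b₂ _ => by
          rw [abs_mul]
          refine mul_le_mul ?_ (hinvA' b₂ b') (abs_nonneg _) (Finset.sum_nonneg fun _ _ => by positivity)
          rw [Matrix.mul_apply]
          refine (Finset.abs_sum_le_sum_abs _ _).trans (Finset.sum_le_sum fun b₁ _ => ?_)
          rw [abs_mul]
          exact mul_le_mul (hinvA b b₁) (hmid b₁ b₂) (abs_nonneg _) (by positivity)
    _ = (2 / γ) ^ 2 * ε * ∑ b₁, ∑ b₂, Real.exp (-(t * ρ b b₁)) * Real.exp (-(t * ρ b₁ b₂)) * Real.exp (-(t * ρ b₂ b')) := by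
        rw [Finset.sum_comm, Finset.mul_sum]
        refine Finset.sum_congr rfl fun b₂ _ => ?_
        rw [Finset.sum_mul, Finset.mul_sum]
        exact Finset.sum_congr rfl fun b₁ _ => by ring
    _ ≤ (2 / γ) ^ 2 * ε * (Kf (t / 2) ^ 2 * Real.exp (-(t / 2 * ρ b b'))) :=
        mul_le_mul_of_nonneg_left (sum_sum_exp_le hKf hρ hS htpos b b') (by positivity)
    _ = (2 / γ) ^ 2 * ε * Kf (t / 2) ^ 2 * Real.exp (-(t / 2 * ρ b b')) := by ring

/-! ## §3 Σ's rate is P's rate -/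

section TwoData

variable {ν ν' : Type*} [Fintype ν] [Fintype ν'] [DecidableEq ν] [DecidableEq ν']
variable {H : Matrix ν ν ℝ} {Q : Matrix c ν ℝ} {H' : Matrix ν' ν' ℝ} {Q' : Matrix c ν' ℝ} {a : ℝ}

/-- **`abs_effForm_sub_effForm_le` — Σ's RATE IS P's RATE, ENTRYWISE WITH DECAY** [our proof; `effForm_eq_of_reg` (`𝒮 = P⁻¹ − a•1`) + §2 BY NAME]: two constrained data
`(H, Q)` on `ν` and `(H′, Q′)` on `ν′` over the SAME unit index set `c` and the same `a > 0`, each with PART 105's hypotheses (`H` symmetric with nonnegative form, `K` coercive,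
upper bound `Λ` in trial form, `|P(b,b′)| ≤ c₀e^{−δ₀ρ(b,b′)}` for `P = QK⁻¹Qᵀ`), and the RATE letter `|(P − P′)(b,b′)| ≤ εe^{−δ₀ρ(b,b′)}` ⟹
`|(effForm H Q − effForm H′ Q′)(b,b′)| ≤ 4(Λ+a)²·ε·Kf(t∕2)²·e^{−(t∕2)ρ(b,b′)}`, `t = rate Kf (Λ+a)⁻¹ c₀ δ₀` — constants independent of `ν`, `ν′`. -/
theorem abs_effForm_sub_effForm_le (hKf : ∀ r, 0 < r → 0 ≤ Kf r) (hρ : IsPseudoDist ρ) (hS : SumBound ρ Kf) (ha : 0 < a) {γ Λ c₀ δ₀ ε : ℝ}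
    (hγ : 0 < γ) (hΛ : 0 ≤ Λ) (hc₀ : 0 ≤ c₀) (hδ₀ : 0 < δ₀) (hε : 0 ≤ ε)
    (hH : Hᵀ = H) (hpsd : ∀ z : ν → ℝ, 0 ≤ z ⬝ᵥ (H *ᵥ z)) (hK : QGQInverse.Coercive (H + Qᵀ * (a • (1 : Matrix c c ℝ)) * Q) γ)
    (hUB : ∀ B : c → ℝ, ∃ u : ν → ℝ, Q *ᵥ u = B ∧ u ⬝ᵥ (H *ᵥ u) ≤ Λ * (B ⬝ᵥ B))
    (hP : ∀ b b', |blockProp (H + Qᵀ * (a • (1 : Matrix c c ℝ)) * Q) Q b b'| ≤ c₀ * Real.exp (-(δ₀ * ρ b b')))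
    (hH' : H'ᵀ = H') (hpsd' : ∀ z : ν' → ℝ, 0 ≤ z ⬝ᵥ (H' *ᵥ z)) (hK' : QGQInverse.Coercive (H' + Q'ᵀ * (a • (1 : Matrix c c ℝ)) * Q') γ)
    (hUB' : ∀ B : c → ℝ, ∃ u : ν' → ℝ, Q' *ᵥ u = B ∧ u ⬝ᵥ (H' *ᵥ u) ≤ Λ * (B ⬝ᵥ B))
    (hP' : ∀ b b', |blockProp (H' + Q'ᵀ * (a • (1 : Matrix c c ℝ)) * Q') Q' b b'| ≤ c₀ * Real.exp (-(δ₀ * ρ b b')))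
    (hdiff : ∀ b b', |(blockProp (H + Qᵀ * (a • (1 : Matrix c c ℝ)) * Q) Q -
        blockProp (H' + Q'ᵀ * (a • (1 : Matrix c c ℝ)) * Q') Q') b b'| ≤ ε * Real.exp (-(δ₀ * ρ b b'))) (b b' : c) :
    |(effForm H Q - effForm H' Q') b b'| ≤
      4 * (Λ + a) ^ 2 * ε * Kf (rate Kf (Λ + a)⁻¹ c₀ δ₀ / 2) ^ 2 * Real.exp (-(rate Kf (Λ + a)⁻¹ c₀ δ₀ / 2 * ρ b b')) := by
  set K : Matrix ν ν ℝ := H + Qᵀ * (a • (1 : Matrix c c ℝ)) * Q with hKdef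
  set K' : Matrix ν' ν' ℝ := H' + Q'ᵀ * (a • (1 : Matrix c c ℝ)) * Q' with hK'def
  have hΛa : 0 < Λ + a := by linarith
  have hPco : QGQInverse.Coercive (blockProp K Q) (Λ + a)⁻¹ := blockProp_coercive_of_ub hH hpsd ha hγ hK hΛ hUB
  have hP'co : QGQInverse.Coercive (blockProp K' Q') (Λ + a)⁻¹ := blockProp_coercive_of_ub hH' hpsd' ha hγ hK' hΛ hUB'
  have hKdet : IsUnit K.det := isUnit_det_of_coercive_fine hγ hK
  have hK'det : IsUnit K'.det := isUnit_det_of_coercive_fine hγ hK'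
  have hPdet : IsUnit (blockProp K Q).det := isUnit_det_of_coercive (inv_pos.mpr hΛa) hPco
  have hP'det : IsUnit (blockProp K' Q').det := isUnit_det_of_coercive (inv_pos.mpr hΛa) hP'co
  -- `𝒮 − 𝒮′ = P⁻¹ − P′⁻¹`
  have hE : effForm H Q - effForm H' Q' = (blockProp K Q)⁻¹ - (blockProp K' Q')⁻¹ := by
    rw [effForm_eq_of_reg H Q (a • (1 : Matrix c c ℝ)) hKdet hPdet, effForm_eq_of_reg H' Q' (a • (1 : Matrix c c ℝ)) hK'det hP'det]
    abel
  rw [hE]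
  have h := abs_inv_sub_inv_le hKf hρ hS (isSymm_blockProp (transpose_reg hH a)) (isSymm_blockProp (transpose_reg hH' a)) (inv_pos.mpr hΛa)
    hc₀ hδ₀ hε hPco hP'co hP hP' hdiff b b'
  have e : (2 / (Λ + a)⁻¹) ^ 2 = 4 * (Λ + a) ^ 2 := by rw [div_inv_eq_mul]; ring
  rwa [e] at h

end TwoData

/-! ## §4 The tower form: the two clauses of (CONV-C) for the effective form from those of the block propagator -/

section Tower

variable {ν : ℕ → Type*} [∀ k, Fintype (ν k)] [∀ k, DecidableEq (ν k)]
variable {H : ∀ k, Matrix (ν k) (ν k) ℝ} {Q : ∀ k, Matrix c (ν k) ℝ} {a : ℝ}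

/-- **`effForm_two_clauses_of_blockProp` — (CONV-C)'s TWO CLAUSES FOR THE EFFECTIVE FORM FROM THOSE OF THE BLOCK PROPAGATOR** [our proof; PART 105 `abs_effForm_le`
+ §3 BY NAME]: a tower of constrained data `(H k, Q k)` on fine index sets `ν k` over ONE unit index set `c` (pseudo-distance `ρ`, profile `Kf`), with k-UNIFORM letters —
`H k` symmetric with nonnegative form, `K k = H k + (Q k)ᵀ(a•1)(Q k)` `γ`-coercive, upper bound `Λ`, decay `|P_k(b,b′)| ≤ c₀e^{−δ₀ρ}` of `P_k = Q_kK_k⁻¹Q_kᵀ` — and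
the Cauchy clause `|(P_{k+1} − P_k)(b,b′)| ≤ C₄θ^k·e^{−δ₀ρ(b,b′)}` (`C₄ ≥ 0`, `θ ≥ 0`) ⟹ with `t = rate Kf (Λ+a)⁻¹ c₀ δ₀`:
(decay) `|𝒮_k(b,b′)| ≤ (2(Λ+a)+a)·e^{−(t∕2)ρ(b,b′)}` and (rate) `|(𝒮_{k+1} − 𝒮_k)(b,b′)| ≤ 4(Λ+a)²Kf(t∕2)²C₄·θ^k·e^{−(t∕2)ρ(b,b′)}` for every `k`. -/
theorem effForm_two_clauses_of_blockProp (hKf : ∀ r, 0 < r → 0 ≤ Kf r) (hρ : IsPseudoDist ρ) (hS : SumBound ρ Kf) (ha : 0 < a)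
    {γ Λ c₀ δ₀ C₄ θ : ℝ} (hγ : 0 < γ) (hΛ : 0 ≤ Λ) (hc₀ : 0 ≤ c₀) (hδ₀ : 0 < δ₀) (hC₄ : 0 ≤ C₄) (hθ : 0 ≤ θ)
    (hH : ∀ k, (H k)ᵀ = H k) (hpsd : ∀ k (z : ν k → ℝ), 0 ≤ z ⬝ᵥ (H k *ᵥ z))
    (hK : ∀ k, QGQInverse.Coercive (H k + (Q k)ᵀ * (a • (1 : Matrix c c ℝ)) * Q k) γ)
    (hUB : ∀ k (B : c → ℝ), ∃ u : ν k → ℝ, Q k *ᵥ u = B ∧ u ⬝ᵥ (H k *ᵥ u) ≤ Λ * (B ⬝ᵥ B))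
    (hP : ∀ k b b', |blockProp (H k + (Q k)ᵀ * (a • (1 : Matrix c c ℝ)) * Q k) (Q k) b b'| ≤ c₀ * Real.exp (-(δ₀ * ρ b b')))
    (hstep : ∀ k b b', |(blockProp (H (k + 1) + (Q (k + 1))ᵀ * (a • (1 : Matrix c c ℝ)) * Q (k + 1)) (Q (k + 1)) -
        blockProp (H k + (Q k)ᵀ * (a • (1 : Matrix c c ℝ)) * Q k) (Q k)) b b'| ≤ C₄ * θ ^ k * Real.exp (-(δ₀ * ρ b b'))) :
    (∀ k b b', |effForm (H k) (Q k) b b'| ≤ (2 * (Λ + a) + a) * Real.exp (-(rate Kf (Λ + a)⁻¹ c₀ δ₀ / 2 * ρ b b'))) ∧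
    (∀ k b b', |(effForm (H (k + 1)) (Q (k + 1)) - effForm (H k) (Q k)) b b'| ≤
      4 * (Λ + a) ^ 2 * Kf (rate Kf (Λ + a)⁻¹ c₀ δ₀ / 2) ^ 2 * C₄ * θ ^ k * Real.exp (-(rate Kf (Λ + a)⁻¹ c₀ δ₀ / 2 * ρ b b'))) := by
  set t : ℝ := rate Kf (Λ + a)⁻¹ c₀ δ₀ with ht
  have hΛa : 0 < Λ + a := by linarith
  have htpos : 0 < t := rate_pos hKf (inv_pos.mpr hΛa) hc₀ hδ₀
  refine ⟨fun k b b' => ?_, fun k b b' => ?_⟩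
  · -- decay clause: PART 105 at rate `t`, weakened to `t/2`
    have h := abs_effForm_le hKf hρ hS (hH k) (hpsd k) ha hγ (hK k) hΛ (hUB k) hc₀ hδ₀ (hP k) b b'
    refine h.trans (mul_le_mul_of_nonneg_left (Real.exp_le_exp.mpr ?_) (by positivity))
    have := hρ.nonneg b b'
    nlinarith
  · -- rate clause: §3 with `ε := C₄θ^k`
    have h := abs_effForm_sub_effForm_le hKf hρ hS ha hγ hΛ hc₀ hδ₀ (by positivity : 0 ≤ C₄ * θ ^ k) (hH (k + 1)) (hpsd (k + 1)) (hK (k + 1))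
      (hUB (k + 1)) (hP (k + 1)) (hH k) (hpsd k) (hK k) (hUB k) (hP k) (hstep k) b b'
    refine h.trans (le_of_eq ?_)
    ring

end Tower

end Summit.QuantumFields.BalabanUV.Beta.GAN24.EffectiveFormRateTransfer

end
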